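import Summits.KontsevichZagierPeriods.KontsevichZagierPeriods.Theorems.SoloInformedEtaleCurve

/-!
# Period symbols on étale graph curves (Rung 2, file E3b)

Solo programme `solo-KontsevichZagierPeriods-informed`, step L4 of `paper/rung2-v2.md`, continued
from `SoloInformedEtaleCurve.lean` (the smooth affine curve
`Z_G = {G(x₀, x₁) = 0, x₂ · ∂_Y G(x₀, x₁) = 1} ⊂ ℂ³` of `G ∈ K[s][Y]`, `K` a field of algebraic
numbers). Here: for `C¹` functions `s, Y` on `(−ε, 1 + ε)` with `G(s, Y) = 0`, `∂_Y G(s, Y) ≠ 0` and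
algebraic end points, the path `γ(t) = (s(t), Y(t), 1/∂_Y G(s(t), Y(t)))` on `Z_G`, the Huber–Wüstholz
period symbol `(Z_G, H ds, γ)` for `H ∈ K[s][Y]`, its period integrand
`Σᵢ ωᵢ(γ) γᵢ′ = H(s(t), Y(t)) · s′(t)` (`SoloInformedEtaleDatum.symbol_integrand`), and the
semialgebraicity of the real and imaginary parts of the coordinates of `γ` when those of `s`, `Y` are
semialgebraic (`SoloInformedEtaleDatum.re_im_path`), so that `γ` is a Nash path in the sense of file B.
[Huber–Wüstholz 2022, Def. 12.6, §13.1; folklore]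
-/

noncomputable section

open Set Filter Topology
open scoped Polynomial
open Literature.NumberTheory.Transcendental Literature.NumberTheory.Transcendental.CurvePeriods
open Literature.ModelTheory.ExponentialFields Literature.FieldTheory.AlgClosed

namespace Summit.KontsevichZagierPeriods.KontsevichZagierPeriods.Theorems

variable {K : Type*} [Field K] [Algebra K ℂ]

/-! ## 3. Étale graph data and the path `γ = (s, Y, 1/∂_Y G(s, Y))` -/

/-- **Étale graph datum**: `G, H ∈ K[s][Y]`, `C¹` functions `s, Y` on `(−ε, 1 + ε)` with
`G(s, Y) = 0`, `∂_Y G(s, Y) ≠ 0` there, and algebraic end points `s(0), Y(0), s(1), Y(1)`. -/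
structure SoloInformedEtaleDatum (K : Type*) [Field K] [Algebra K ℂ] where
  /-- The equation. -/
  G : K[X][X]
  /-- The coefficient of the form `H ds`. -/
  H : K[X][X]
  /-- The `s`-coordinate of the path. -/
  s : ℝ → ℂ
  /-- The `Y`-coordinate of the path. -/
  Y : ℝ → ℂ
  /-- Margin. -/
  ε : ℚ
  /-- The margin is positive. -/
  ε_pos : 0 < ε
  /-- `s` is `C¹` on `(−ε, 1 + ε)`. -/
  s_contDiff : ContDiffOn ℝ 1 s (Ioo (-(ε : ℝ)) (1 + ε))
  /-- `Y` is `C¹` on `(−ε, 1 + ε)`. -/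
  Y_contDiff : ContDiffOn ℝ 1 Y (Ioo (-(ε : ℝ)) (1 + ε))
  /-- `G(s, Y) = 0`. -/
  root : ∀ t ∈ Ioo (-(ε : ℝ)) (1 + ε), soloInformedEvC G (s t) (Y t) = 0
  /-- `∂_Y G(s, Y) ≠ 0`. -/
  etale : ∀ t ∈ Ioo (-(ε : ℝ)) (1 + ε), soloInformedEvC (Polynomial.derivative G) (s t) (Y t) ≠ 0
  /-- `s(0)` is algebraic. -/
  s_zero : IsAlgebraic ℚ (s 0)
  /-- `Y(0)` is algebraic. -/
  Y_zero : IsAlgebraic ℚ (Y 0)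
  /-- `s(1)` is algebraic. -/
  s_one : IsAlgebraic ℚ (s 1)
  /-- `Y(1)` is algebraic. -/
  Y_one : IsAlgebraic ℚ (Y 1)

namespace SoloInformedEtaleDatum

variable (D : SoloInformedEtaleDatum K)

/-- The path `γ(t) = (s(t), Y(t), 1/∂_Y G(s(t), Y(t)))`. -/
def path (t : ℝ) : Fin 3 → ℂ :=
  ![D.s t, D.Y t, (soloInformedEvC (Polynomial.derivative D.G) (D.s t) (D.Y t))⁻¹]

/-- Coordinates of the path. -/
@[simp] theorem path_zero (t : ℝ) : D.path t 0 = D.s t := rfl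

/-- Coordinates of the path. -/
@[simp] theorem path_one (t : ℝ) : D.path t 1 = D.Y t := rfl

/-- Coordinates of the path. -/
@[simp] theorem path_two (t : ℝ) :
    D.path t 2 = (soloInformedEvC (Polynomial.derivative D.G) (D.s t) (D.Y t))⁻¹ := rfl

/-- `[0, 1] ⊆ (−ε, 1 + ε)`. -/
theorem Icc_subset : Icc (0 : ℝ) 1 ⊆ Ioo (-(D.ε : ℝ)) (1 + D.ε) := fun t ht =>
  ⟨by linarith [ht.1, (Rat.cast_pos.2 D.ε_pos : (0:ℝ) < D.ε)],
   by linarith [ht.2, (Rat.cast_pos.2 D.ε_pos : (0:ℝ) < D.ε)]⟩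

/-- `t ↦ ∂_Y G(s(t), Y(t))` is `C¹` on `(−ε, 1 + ε)`. -/
theorem contDiffOn_dY : ContDiffOn ℝ 1
    (fun t => soloInformedEvC (Polynomial.derivative D.G) (D.s t) (D.Y t)) (Ioo (-(D.ε : ℝ)) (1 + D.ε)) :=
  (soloInformed_contDiff_evC (Polynomial.derivative D.G)).comp_contDiffOn (D.s_contDiff.prodMk D.Y_contDiff)

/-- **The path is `C¹` on `(−ε, 1 + ε)`.** -/
theorem contDiffOn_path : ContDiffOn ℝ 1 D.path (Ioo (-(D.ε : ℝ)) (1 + D.ε)) := by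
  refine contDiffOn_pi.2 fun i => ?_
  fin_cases i
  · exact D.s_contDiff
  · exact D.Y_contDiff
  · exact D.contDiffOn_dY.inv D.etale

/-- The path lies on `Z_G` over `(−ε, 1 + ε)`. -/
theorem path_mem {t : ℝ} (ht : t ∈ Ioo (-(D.ε : ℝ)) (1 + D.ε)) :
    D.path t ∈ (soloInformedEtaleCurve D.G).points := by
  rw [soloInformed_mem_etaleCurve]
  exact ⟨D.root t ht, inv_mul_cancel₀ (D.etale t ht)⟩

/-- **The `C¹` path `γ` on `Z_G` with algebraic end points** (for `K` of algebraic numbers). -/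
def curvePath (hK : ∀ a : K, IsAlgebraic ℚ (algebraMap K ℂ a)) :
    CurvePath (soloInformedEtaleCurve D.G) where
  toFun := D.path
  contDiffOn := D.contDiffOn_path.mono D.Icc_subset
  mem_points t ht := D.path_mem (D.Icc_subset ht)
  algebraic_zero i := by
    fin_cases i
    · exact D.s_zero
    · exact D.Y_zero
    · exact (soloInformed_isAlgebraic_evC hK _ D.s_zero D.Y_zero).inv
  algebraic_one i := by
    fin_cases i
    · exact D.s_one
    · exact D.Y_one
    · exact (soloInformed_isAlgebraic_evC hK _ D.s_one D.Y_one).inv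

/-- **The étale graph symbol `(Z_G, H ds, γ)`.** -/
abbrev symbol (hK : ∀ a : K, IsAlgebraic ℚ (algebraMap K ℂ a)) : PeriodSymbol where
  Z := soloInformedEtaleCurve D.G
  smooth := soloInformed_isSmoothAffineCurve_etaleCurve hK D.G
  ω := ![soloInformedToMv3 D.H, 0, 0]
  ω_algebraic i := by
    fin_cases i
    · exact soloInformed_hasAlgCoeffs_toMv3 hK D.H
    · exact hasAlgCoeffs_zero
    · exact hasAlgCoeffs_zero
  γ := D.curvePath hK

/-- The path of the symbol. -/
@[simp] theorem symbol_γ (hK : ∀ a : K, IsAlgebraic ℚ (algebraMap K ℂ a)) (t : ℝ) :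
    (D.symbol hK).γ.toFun t = D.path t := rfl

/-- **Period integrand of the étale graph symbol**: `Σᵢ ωᵢ(γ(t)) γᵢ′(t) = H(s(t), Y(t)) · s′(t)`. -/
theorem symbol_integrand (hK : ∀ a : K, IsAlgebraic ℚ (algebraMap K ℂ a)) (t : ℝ) :
    ∑ i, MvPolynomial.eval ((D.symbol hK).γ.toFun t) ((D.symbol hK).ω i) *
        deriv (fun u => (D.symbol hK).γ.toFun u i) t =
      soloInformedEvC D.H (D.s t) (D.Y t) * deriv D.s t := by
  rw [Fin.sum_univ_three]
  show MvPolynomial.eval (D.path t) (soloInformedToMv3 D.H) * deriv (fun u => D.s u) t +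
      MvPolynomial.eval (D.path t) 0 * deriv (fun u => D.Y u) t +
      MvPolynomial.eval (D.path t) 0 * deriv (fun u => D.path u 2) t = _
  rw [map_zero, zero_mul, add_zero, zero_mul, add_zero, soloInformed_eval_toMv3]
  rfl

/-! ## 4. Semialgebraic real and imaginary parts -/

/-- `G(F₁, F₂)` has semialgebraic real and imaginary parts when `F₁`, `F₂` do (and `K` consists of
algebraic numbers). -/
theorem re_im_evC (hK : ∀ a : K, IsAlgebraic ℚ (algebraMap K ℂ a)) (G : K[X][X]) {m : ℕ}
    {S : Set (Fin m → ℝ)} (hS : IsSemialgebraic ℚ S) {F₁ F₂ : (Fin m → ℝ) → ℂ}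
    (h₁ : IsSemialgebraicFunOn ℚ S (fun x => (F₁ x).re) ∧ IsSemialgebraicFunOn ℚ S (fun x => (F₁ x).im))
    (h₂ : IsSemialgebraicFunOn ℚ S (fun x => (F₂ x).re) ∧ IsSemialgebraicFunOn ℚ S (fun x => (F₂ x).im)) :
    IsSemialgebraicFunOn ℚ S (fun x => (soloInformedEvC G (F₁ x) (F₂ x)).re) ∧
      IsSemialgebraicFunOn ℚ S (fun x => (soloInformedEvC G (F₁ x) (F₂ x)).im) := by
  have hin : ∀ a : K[X], IsSemialgebraicFunOn ℚ S (fun x => (Polynomial.eval₂ (algebraMap K ℂ) (F₁ x) a).re) ∧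
      IsSemialgebraicFunOn ℚ S (fun x => (Polynomial.eval₂ (algebraMap K ℂ) (F₁ x) a).im) := by
    intro a
    induction a using Polynomial.induction_on' with
    | add p q hp hq => simpa only [Polynomial.eval₂_add] using re_im_add hp hq
    | monomial n c =>
      simp only [Polynomial.eval₂_monomial]
      have hc := isAlgebraic_re_im (hK c)
      exact re_im_mul (re_im_const hS hc.1 hc.2) (re_im_pow hS h₁ n)
  simp_rw [← soloInformedEvCHom_apply]
  induction G using Polynomial.induction_on' with
  | add p q hp hq => simpa only [map_add] using re_im_add hp hq
  | monomial n a =>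
    have h : ∀ x, soloInformedEvCHom (F₁ x) (F₂ x) (Polynomial.monomial n a) =
        Polynomial.eval₂ (algebraMap K ℂ) (F₁ x) a * F₂ x ^ n := by
      intro x
      rw [← Polynomial.C_mul_X_pow_eq_monomial, map_mul, map_pow]
      simp only [soloInformedEvCHom, RingHom.comp_apply, Polynomial.coe_mapRingHom, Polynomial.map_C,
        Polynomial.map_X, Polynomial.coe_evalRingHom, Polynomial.eval_C, Polynomial.eval_X,
        Polynomial.coe_eval₂RingHom]
    simp_rw [h]
    exact re_im_mul (hin a) (re_im_pow hS h₂ n)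

/-- **The coordinates of `γ` have semialgebraic real and imaginary parts** on any semialgebraic
`S ⊆ ℝ¹` mapped into `(−ε, 1 + ε)` on which those of `s` and `Y` are semialgebraic. -/
theorem re_im_path (hK : ∀ a : K, IsAlgebraic ℚ (algebraMap K ℂ a)) {S : Set (Fin 1 → ℝ)}
    (hS : IsSemialgebraic ℚ S) (hSε : ∀ x ∈ S, x 0 ∈ Ioo (-(D.ε : ℝ)) (1 + D.ε))
    (hs : IsSemialgebraicFunOn ℚ S (fun x => (D.s (x 0)).re) ∧ IsSemialgebraicFunOn ℚ S (fun x => (D.s (x 0)).im))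
    (hY : IsSemialgebraicFunOn ℚ S (fun x => (D.Y (x 0)).re) ∧ IsSemialgebraicFunOn ℚ S (fun x => (D.Y (x 0)).im))
    (i : Fin 3) :
    IsSemialgebraicFunOn ℚ S (fun x => (D.path (x 0) i).re) ∧
      IsSemialgebraicFunOn ℚ S (fun x => (D.path (x 0) i).im) := by
  fin_cases i
  · simpa using hs
  · simpa using hY
  · simpa using re_im_inv (re_im_evC hK (Polynomial.derivative D.G) hS hs hY)
      fun x hx => D.etale _ (hSε x hx)

end SoloInformedEtaleDatum

end Summit.KontsevichZagierPeriods.KontsevichZagierPeriods.Theorems
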